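import Summits.BirchSwinnertonDyer.BirchSwinnertonDyer.Theorems.GenusKolyvaginAtTwoMinimalTwinBSDTwoKrizLiAnchorWallAdd
import Summits.BirchSwinnertonDyer.BirchSwinnertonDyer.Theorems.ByReductionTypeAtTwoAdditivePotGoodPrintKrizLi92b1Base
import Literature.NumberTheory.EllipticCurves.KrizLi2019.Table1RankOneRowsAdditiveAtTwo
import Literature.NumberTheory.EllipticCurves.IsogenyHasCMIffJMemProofs
import Literature.NumberTheory.EllipticCurves.OrdinaryPrimesProofs
import Literature.NumberTheory.EllipticCurves.LeadingTermTamagawaProofs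
import Literature.NumberTheory.EllipticCurves.HeegnerHypothesisKroneckerProofs
import Literature.NumberTheory.QuadraticFields.KroneckerSplitting
import Mathlib.Tactic.NormNum.LegendreSymbol
import HarnessLib

/-!
# Route `GenusKolyvaginAtTwo`, crux U₂ `MinimalTwinBSDTwo` (stmt-BirchSwinnertonDyer-22985), LINE 23 «twin_swap»: KERNEL data of the Kriz–Li RANK-ONE ANCHOR
# `196a1 = [0,-1,0,-2,1]` (`y² = x³ − x² − 2x + 1`; `N = 196 = 2²·7²`, `Δ = 784 = 2⁴·7²`, `j = 1792 = 2⁸·7`, Kodaira `IV` at `2` (`c₂ = 3`) and `II` at `7`;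
# Kriz–Li Table 1 row `196a1 | -31 | 3 | ✓`) over `K = ℚ(√-31)` — the LAST of the four rank-one rows ADDITIVE at `2` (`124a1`, `148a1`, `172a1` by g34)
# and the only Table-1 anchor with NO multiplicative prime (non-CM is read off `j = 1792 ∉` the thirteen CM invariants)

Seat `bsd-line-gk2-p2` g35 (PROVER 2/3, cell `bsd-f1-sign2`; LINE 23 holder), `--supports stmt-BirchSwinnertonDyer-22985` (helper; closes nothing).
KERNEL THEOREMS ONLY (0 `def`, 0 `sorry`); standard axioms; the one print binder displayed here is Agashe–Ribet–Stein (`h26`, the Manin constant of the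
OPTIMAL datum is odd, needed by Kriz–Li Thm 5.1 (2) at an ADDITIVE `2`).  Companion of `…KrizLiAnchor124a1Base.lean` (g34, same generator shape).  Kernel:
ellipticity, global minimality, `E[2]` irreducible (the `2`-division cubic `X³ − 4X² − 32X + 64` has no root mod `3`), Kodaira `IV` at `2` by a Step2Cert
certificate `⟨2,0,0,1,4,4,2⟩` (`f₂ = 2`, `c₂ ∣ 3` odd), additive potentially good at `2` (`ord₂ j = 8`), Kodaira `II` at `7` by a Step2Cert certificate
`⟨7,-2,0,0,2,2,0⟩` (`f₇ = 2`), NON-CM by `j = 1792 ∉ cmJInvariants` (tree `WeierstrassCurve.hasCM_iff_j_mem_holds`, Silverman App. C §11), `N = 196 = 2²·7²`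
exactly, the point `5·(0,1) = (4/9, 1/27)` of infinite order (denominator divisible by `3`), the Heegner hypothesis for `(196, -31)` (`-31 ≡ 1 (mod 8)`,
`(-31/7) = 1`), the witnesses `#Ẽ(𝔽₅) = 9` (`a₅ = -3` odd) and `#Ẽ(𝔽₁₀₁) = 117` (`a₁₀₁ = -15` odd).  Road: `…KrizLiAnchor196a1.lean` (additive wall row 19098 +
PRINT).  Closes nothing; nothing booked; **BSD is NOT proved by any of this; U₂ is NOT proved.**

References: [KrizLi2019] Thm 5.1 (2), Def 4.1, §6 Ex. 6.2, Table 1 (row 196a1, arXiv:1606.03172v3 Congruence.tex l. 998); [CremonaAlgorithms1997] Table 1 (196A1);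
[AgasheRibetStein2006] Thm. 2.6; [Silverman1994] IV.9.4, IV.11.1; [SilvermanAEC2009] III.1, III.2.3, VII.1, VII.3.4, VII.5, X.5, App. C §11; [Kraus1989] Prop. 1–2;
[Marcus1977] Ch. 3 Thm. 25.
-/

set_option autoImplicit false
-- the Theorems namespace of this sub repeats the summit name by design (D-0017 nested layout)
set_option linter.dupNamespace false

noncomputable section

open scoped Classical NumberField

open WeierstrassCurve IsDedekindDomain Rat.HeightOneSpectrum NumberField Literature.NumberTheory.EllipticCurves
  Literature.NumberTheory.EllipticCurves.ModularForms
  Literature.NumberTheory.EllipticCurves.Rank1Residual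
  Literature.NumberTheory.EllipticCurves.Rank1Residual.Typed
  Literature.NumberTheory.DiophantineGeometry
  Summit.BirchSwinnertonDyer
  Summit.BirchSwinnertonDyer.Rank1Residual
  Summit.BirchSwinnertonDyer.Rank1Residual.X11b
  Summit.BirchSwinnertonDyer.Rank1Residual.X5.O1
  Summit.BirchSwinnertonDyer.Rank1Residual.P2
  Summit.BirchSwinnertonDyer.BirchSwinnertonDyer.Rank1Residual.IntModel
  Summit.BirchSwinnertonDyer.BirchSwinnertonDyer.Theorems
  Summit.BirchSwinnertonDyer.BirchSwinnertonDyer.Theorems.AddPotGoodPrint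
  Summit.BirchSwinnertonDyer.BirchSwinnertonDyer.Theorems.GenusExact.TwinSwap.KrizLiAnchorWall
  Summit.BirchSwinnertonDyer.BirchSwinnertonDyer.Rank2Observatory.Tate
  Literature.NumberTheory.EllipticCurves.AgasheRibetStein2006

namespace Summit.BirchSwinnertonDyer.BirchSwinnertonDyer.Theorems.GenusExact.TwinSwap.KrizLiAnchor196a1

/-! ## §1 The anchor `196a1 = [0, -1, 0, -2, 1]`: `Δ = 784`, `c₄ = 112`, `IV` at `2`, `II` at `7`, `j = 1792` -/
section Base196A1

/-- `196a1` is an elliptic curve (`Δ = 784 ≠ 0`). [cite: CremonaAlgorithms1997, Table 1 (196A1)] -/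
theorem isElliptic_196A1 : (⟨0, -1, 0, -2, 1⟩ : WeierstrassCurve ℚ).IsElliptic := ⟨by
  rw [isUnit_iff_ne_zero]; norm_num [WeierstrassCurve.Δ, WeierstrassCurve.b₂, WeierstrassCurve.b₄, WeierstrassCurve.b₆, WeierstrassCurve.b₈]⟩

/-- `196a1` is GLOBALLY MINIMAL (`|Δ| = 2^4·7^2`: `v_p Δ < 12` everywhere). [cite: SilvermanAEC2009, VII.1 Remark 1.1] [cite: Kraus1989, Prop. 1 and Prop. 2] -/
theorem isGloballyMinimal_196A1 : (⟨0, -1, 0, -2, 1⟩ : WeierstrassCurve ℚ).IsGloballyMinimal :=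
  isGloballyMinimal_of_krausCriterion_support (0) (-1) (0) (-2) (1) [(2, 0, 4), (7, 0, 2)]
    (by intro t ht; simp only [List.mem_cons, List.not_mem_nil, or_false] at ht
        rcases ht with rfl | rfl <;> norm_num)
    (by decide +kernel) (by decide +kernel)

/-- `Δ(196a1) = 784` on the integer model. [cite: CremonaAlgorithms1997, Table 1 (196A1)] -/
theorem M196A1_Δ : (⟨0, -1, 0, -2, 1⟩ : WeierstrassCurve ℤ).Δ = 784 := by decide +kernel
/-- `c₄(196a1) = 112` on the integer model. [cite: CremonaAlgorithms1997, Table 1 (196A1)] -/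
theorem M196A1_c₄ : (⟨0, -1, 0, -2, 1⟩ : WeierstrassCurve ℤ).c₄ = 112 := by decide +kernel
/-- The integer model of `196a1` is Cremona's. [cite: SilvermanAEC2009, VIII.8] -/
theorem intModel_196A1 :
    haveI := isElliptic_196A1; haveI := isGloballyMinimal_196A1
    integralModelInt (⟨0, -1, 0, -2, 1⟩ : WeierstrassCurve ℚ) = (⟨0, -1, 0, -2, 1⟩ : WeierstrassCurve ℤ) :=
  haveI := isElliptic_196A1; haveI := isGloballyMinimal_196A1
  integralModelInt_eq_of_map_eq _ (by ext <;> simp [WeierstrassCurve.map])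

/-- The integer model base-changed to `ℚ` is the rational model. [folklore] -/
theorem baseChange_int_196A1 : (⟨0, -1, 0, -2, 1⟩ : WeierstrassCurve ℤ).baseChange ℚ = (⟨0, -1, 0, -2, 1⟩ : WeierstrassCurve ℚ) := by
  ext <;> simp [WeierstrassCurve.baseChange, WeierstrassCurve.map]

/-- `b₂, b₄, b₆` of `196a1`. [cite: SilvermanAEC2009, III.1] -/
theorem b_196A1 : (⟨0, -1, 0, -2, 1⟩ : WeierstrassCurve ℚ).b₂ = ((-4 : ℤ) : ℚ) ∧ (⟨0, -1, 0, -2, 1⟩ : WeierstrassCurve ℚ).b₄ = ((-4 : ℤ) : ℚ) ∧ (⟨0, -1, 0, -2, 1⟩ : WeierstrassCurve ℚ).b₆ = ((4 : ℤ) : ℚ) := by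
  simp only [WeierstrassCurve.b₂, WeierstrassCurve.b₄, WeierstrassCurve.b₆]; norm_num

/-- **`E[2]` irreducible for `196a1`** (`E(ℚ)[2] = 0`; Cremona `#T = 1`): the monic `2`-division cubic `X³ − 4X² − 32X + 64` has no root modulo `3`.
[cite: SilvermanAEC2009, III.2.3 (b)] [cite: KrizLi2019, Thm. 5.1 (hypothesis E(ℚ)[2] = 0)] -/
theorem irr_two_196A1 :
    haveI := isElliptic_196A1
    Irr (⟨0, -1, 0, -2, 1⟩ : WeierstrassCurve ℚ) 2 :=
  haveI := isElliptic_196A1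
  irr_two_of_forall_cubic_ne _ b_196A1.1 b_196A1.2.1 b_196A1.2.2 (ℓ := 3) (by decide)

/-- **`E(ℚ)[2] = 0` for `196a1`** in Kriz–Li's shape. [cite: KrizLi2019, Thm. 5.1 hypothesis "E(ℚ)[2] = 0"] -/
theorem twoTorsion_196A1 :
    haveI := isElliptic_196A1
    ∀ Q : (⟨0, -1, 0, -2, 1⟩ : WeierstrassCurve ℚ).toAffine.Point, 2 • Q = 0 → Q = 0 :=
  haveI := isElliptic_196A1
  (X5.O1.irr_two_iff_forall_two_nsmul _).mp irr_two_196A1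

/-- **Tate certificate for `196a1` at `2`, kernel check** (Steps 1–4): translate by `(r,s,t) = (0,0,1)` to `[0,-1,2,-2,0]`; Step 4 exit: `4 ∣ a₆`, `8 ∣ b₈`,
`2² ∥ b₆` — type `IV`, `v₂(Δ) = 4`. [cite: Silverman1994, IV.9.4 Steps 1–4] -/
theorem tateStep2Check_two_196A1 : Step2Cert.check ⟨2, 0, 0, 1, 4, 4, 2⟩ ⟨0, -1, 0, -2, 1⟩ = true := by
  decide +kernel

/-- **`196a1` has Kodaira type `IV` and `ord₂ Δ_min = 4` at the place above `2`.** [cite: Silverman1994, IV.9.4 Step 4] -/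
theorem kodairaSymbolAt_two_196A1 (v : HeightOneSpectrum (𝓞 ℚ)) (hv : natGenerator v = 2) :
    (⟨0, -1, 0, -2, 1⟩ : WeierstrassCurve ℚ).kodairaSymbolAt v = .IV ∧ (⟨0, -1, 0, -2, 1⟩ : WeierstrassCurve ℚ).ordMinimalDiscriminant v = 4 := by
  have h := Step2Cert.sound (W₀ := ⟨0, -1, 0, -2, 1⟩) (c := ⟨2, 0, 0, 1, 4, 4, 2⟩) v hv tateStep2Check_two_196A1
  rw [baseChange_int_196A1] at h
  exact h

/-- **`f₂(196a1) = 2`** (Ogg: `4 + 1 − 3` components of `IV`). [cite: Silverman1994, IV.11.1] -/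
theorem conductorExponent_two_196A1 (v : HeightOneSpectrum ℤ) (hv : natGenerator v = 2) :
    (⟨0, -1, 0, -2, 1⟩ : WeierstrassCurve ℚ).conductorExponent v = 2 := by
  have h := Step2Cert.conductorExponent_int_eq (W₀ := ⟨0, -1, 0, -2, 1⟩) (c := ⟨2, 0, 0, 1, 4, 4, 2⟩) v hv
    tateStep2Check_two_196A1
  rw [baseChange_int_196A1] at h
  exact h

/-- **Tate certificate for `196a1` at `7`, kernel check** (Steps 1–2): translate by `(r,s,t) = (-2,0,0)` to `[0,-7,0,14,-7]` (`7 ∣ a₃, a₄, b₂`, `7 ∥ a₆`) —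
type `II`, `v₇(Δ) = 2`. [cite: Silverman1994, IV.9.4 Steps 1–2] -/
theorem tateStep2Check_seven_196A1 : Step2Cert.check ⟨7, -2, 0, 0, 2, 2, 0⟩ ⟨0, -1, 0, -2, 1⟩ = true := by
  decide +kernel

/-- **`f₇(196a1) = 2`** (Ogg: `2 + 1 − 1` components of `II`). [cite: Silverman1994, IV.11.1] -/
theorem conductorExponent_seven_196A1 (v : HeightOneSpectrum ℤ) (hv : natGenerator v = 7) :
    (⟨0, -1, 0, -2, 1⟩ : WeierstrassCurve ℚ).conductorExponent v = 2 := by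
  have h := Step2Cert.conductorExponent_int_eq (W₀ := ⟨0, -1, 0, -2, 1⟩) (c := ⟨7, -2, 0, 0, 2, 2, 0⟩) v hv
    tateStep2Check_seven_196A1
  rw [baseChange_int_196A1] at h
  exact h

/-- **`196a1` is ADDITIVE at `2`** (`2 ∣ Δ`, `2 ∣ c₄` on the minimal model). [cite: SilvermanAEC2009, VII.5 Prop. 5.1 (c)] -/
theorem addv_two_196A1 :
    haveI := isElliptic_196A1; haveI := isGloballyMinimal_196A1; haveI : Fact (Nat.Prime 2) := ⟨Nat.prime_two⟩
    Addv (⟨0, -1, 0, -2, 1⟩ : WeierstrassCurve ℚ) 2 := by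
  haveI : Fact (Nat.Prime 2) := ⟨Nat.prime_two⟩
  haveI := isElliptic_196A1; haveI := isGloballyMinimal_196A1
  exact Additive.addv_of_intModel intModel_196A1 2 (by rw [M196A1_Δ]; decide) (by rw [M196A1_c₄]; decide)

/-- **`ord₂ j(196a1) = 8 ≥ 0`** (`j = 2⁸·7`: potentially good at `2`). [cite: SilvermanAEC2009, III.1 and VII.5 Prop. 5.5] -/
theorem padicValRat_j_196A1 :
    haveI := isElliptic_196A1
    padicValRat 2 (⟨0, -1, 0, -2, 1⟩ : WeierstrassCurve ℚ).j = 8 := by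
  haveI : Fact (Nat.Prime 2) := ⟨Nat.prime_two⟩
  haveI := isElliptic_196A1; haveI := isGloballyMinimal_196A1
  rw [AdditivePotMult.padicValRat_j_eq_of_intModel intModel_196A1 2 4 4 (by rw [M196A1_c₄]; decide) (by rw [M196A1_c₄]; decide)
    (by rw [M196A1_Δ]; decide) (by rw [M196A1_Δ]; decide)]
  norm_num

/-- **`c₂(196a1)` is ODD** (Kriz–Li: `c₂ = 3`): the local Tamagawa number divides the order `3` of the geometric component group of type `IV`.
[cite: KrizLi2019, Thm. 5.1 (hypothesis "c₂(E) odd") and §6 Table 1 (row 196a1: c₂ = 3)] [cite: Silverman1994, IV.9 Table 4.1 and Cor. 9.2] -/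
theorem odd_localTamagawaNumber_two_196A1 :
    haveI := isElliptic_196A1; haveI : Fact (Nat.Prime 2) := ⟨Nat.prime_two⟩
    Odd (((⟨0, -1, 0, -2, 1⟩ : WeierstrassCurve ℚ).baseChange ℚ_[2]).localTamagawaNumber ℤ_[2]) := by
  haveI := isElliptic_196A1
  haveI : Fact (Nat.Prime 2) := ⟨Nat.prime_two⟩
  set v : HeightOneSpectrum (𝓞 ℚ) := (primesEquiv (R := 𝓞 ℚ)).symm ⟨2, Nat.prime_two⟩ with hv
  have hv2 : (primesEquiv v : ℕ) = 2 := by rw [hv, Equiv.apply_symm_apply]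
  have hgen : natGenerator v = 2 := hv2
  rw [localTamagawaNumber_padic_eq_holds (⟨0, -1, 0, -2, 1⟩ : WeierstrassCurve ℚ) v 2 hv2]
  have hdvd := localTamagawaNumber_dvd_componentGroupOrder v (⟨0, -1, 0, -2, 1⟩ : WeierstrassCurve ℚ) (nonempty_neronComponentData_holds _ v)
  rw [(kodairaSymbolAt_two_196A1 v hgen).1] at hdvd
  change _ ∣ 3 at hdvd
  rcases (Nat.dvd_prime Nat.prime_three).mp hdvd with h | h
  · rw [h]; exact odd_one
  · rw [h]; exact ⟨1, rfl⟩

/-- **`j(196a1) = 1792 = 2⁸·7`** (`c₄³/Δ = 112³/784`). [cite: CremonaAlgorithms1997, Table 1 (196A1)] [cite: SilvermanAEC2009, III.1] -/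
theorem j_196A1 :
    haveI := isElliptic_196A1
    (⟨0, -1, 0, -2, 1⟩ : WeierstrassCurve ℚ).j = 1792 := by
  haveI := isElliptic_196A1
  rw [WeierstrassCurve.j, Units.val_inv_eq_inv_val, WeierstrassCurve.coe_Δ']
  norm_num [WeierstrassCurve.c₄, WeierstrassCurve.Δ, WeierstrassCurve.b₂, WeierstrassCurve.b₄, WeierstrassCurve.b₆, WeierstrassCurve.b₈]

/-- **`196a1` is non-CM**: `j = 1792` is not one of the thirteen rational CM invariants (`196a1` has NO multiplicative prime, so the lineage's
`ord_ℓ j < 0` test does not apply; tree theorem `WeierstrassCurve.hasCM_iff_j_mem_holds`). [cite: SilvermanAEC2009, App. C §11 Examples 11.3.1–11.3.2] -/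
theorem not_hasCM_196A1 :
    haveI := isElliptic_196A1
    ¬ (⟨0, -1, 0, -2, 1⟩ : WeierstrassCurve ℚ).HasCM := by
  haveI := isElliptic_196A1
  intro hCM
  have hmem := (WeierstrassCurve.hasCM_iff_j_mem_holds (⟨0, -1, 0, -2, 1⟩ : WeierstrassCurve ℚ)).mp hCM
  rw [j_196A1] at hmem
  revert hmem
  decide

/-- **`1 ≤ rank_ℤ 196a1(ℚ)` IN THE KERNEL**: the rational point `5·(0,1) = (4/9, 1/27)` has `3` in its denominator, so it has infinite order (Silverman VII.3.4,
tree `one_le_mordellWeilRank_of_dvd_den`). [cite: SilvermanAEC2009, VII.3.4 and Thm. VIII.6.7] [cite: CremonaAlgorithms1997, Table 1 (196A1: r = 1)] -/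
theorem one_le_mordellWeilRank_196A1 :
    haveI := isElliptic_196A1; haveI := isGloballyMinimal_196A1
    1 ≤ (⟨0, -1, 0, -2, 1⟩ : WeierstrassCurve ℚ).mordellWeilRank :=
  haveI := isElliptic_196A1; haveI := isGloballyMinimal_196A1
  haveI : Fact (Nat.Prime 3) := ⟨by norm_num⟩
  one_le_mordellWeilRank_of_dvd_den (⟨0, -1, 0, -2, 1⟩ : WeierstrassCurve ℚ) 3 (by norm_num) (x := 4 / 9) (y := 1 / 27)
    (WeierstrassCurve.Affine.equation_iff_nonsingular.mp (by rw [WeierstrassCurve.Affine.equation_iff]; norm_num))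
    (by norm_num)

/-- **`N(196a1) ∣ |Δ_min| = 784`.** [cite: SilvermanAEC2009, VIII.11 and C.16] -/
theorem conductorNorm_dvd_196A1 :
    haveI := isElliptic_196A1
    (⟨0, -1, 0, -2, 1⟩ : WeierstrassCurve ℚ).conductorNorm ℤ ∣ 784 := by
  haveI := isElliptic_196A1; haveI := isGloballyMinimal_196A1
  have hdvd := WeierstrassCurve.conductorNorm_dvd_minimalDiscriminantNorm (⟨0, -1, 0, -2, 1⟩ : WeierstrassCurve ℚ)
    (WeierstrassCurve.finite_setOf_ordMinimalDiscriminant_ne_zero_holds _)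
  rw [WeierstrassCurve.minimalDiscriminantNorm_int_eq_natAbs_minimalDiscriminantInt_holds,
    minimalDiscriminantInt_eq intModel_196A1, M196A1_Δ] at hdvd
  exact hdvd

/-- **`ord₂ N(196a1) = 2`, `ord₇ N(196a1) = 2`** (the two Step2Cert certificates). [cite: Silverman1994, IV.11.1] -/
theorem factorization_conductorNorm_196A1 :
    haveI := isElliptic_196A1
    (((⟨0, -1, 0, -2, 1⟩ : WeierstrassCurve ℚ).conductorNorm ℤ).factorization 2 = 2) ∧ (((⟨0, -1, 0, -2, 1⟩ : WeierstrassCurve ℚ).conductorNorm ℤ).factorization 7 = 2) := by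
  haveI := isElliptic_196A1; haveI := isGloballyMinimal_196A1
  have h7 : Nat.Prime 7 := by norm_num
  refine ⟨?_, ?_⟩
  · rw [show (2 : ℕ) = ((⟨2, Nat.prime_two⟩ : Nat.Primes) : ℕ) from rfl, factorization_conductorNorm_primesEquiv_symm]
    exact conductorExponent_two_196A1 _ (congrArg Subtype.val ((primesEquiv (R := ℤ)).apply_symm_apply ⟨2, Nat.prime_two⟩))
  · rw [show (7 : ℕ) = ((⟨7, h7⟩ : Nat.Primes) : ℕ) from rfl, factorization_conductorNorm_primesEquiv_symm]
    exact conductorExponent_seven_196A1 _ (congrArg Subtype.val ((primesEquiv (R := ℤ)).apply_symm_apply ⟨7, h7⟩))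

/-- The prime factorisation of `2ᵃ·7ᵇ`, read coefficientwise. [folklore] -/
theorem factorization_2_pow_mul_7_pow_196A1 (a b r : ℕ) :
    (2 ^ a * 7 ^ b).factorization r = if r = 2 then a else if r = 7 then b else 0 := by
  have hp : Nat.Prime 2 := by norm_num
  have hq : Nat.Prime 7 := by norm_num
  rw [Nat.factorization_mul (pow_ne_zero _ hp.ne_zero) (pow_ne_zero _ hq.ne_zero), Finsupp.add_apply,
    Nat.factorization_pow, Nat.factorization_pow, Finsupp.smul_apply, Finsupp.smul_apply, hp.factorization, hq.factorization,
    Finsupp.single_apply, Finsupp.single_apply]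
  by_cases hrp : r = 2
  · subst hrp; simp
  by_cases hrq : r = 7
  · subst hrq; simp
  · simp [Ne.symm hrp, Ne.symm hrq, hrp, hrq]

/-- **`N(196a1) = 196 = 2²·7²` IN THE KERNEL** (`N ∣ 2^4·7^2`, `ord₂ N = ord₇ N = 2`). [cite: CremonaAlgorithms1997, Table 1 (196A1)] -/
theorem conductorNorm_196A1 :
    haveI := isElliptic_196A1
    (⟨0, -1, 0, -2, 1⟩ : WeierstrassCurve ℚ).conductorNorm ℤ = 196 := by
  haveI := isElliptic_196A1
  set N := (⟨0, -1, 0, -2, 1⟩ : WeierstrassCurve ℚ).conductorNorm ℤ with hN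
  have hN0 : N ≠ 0 := (conductorNorm_pos_holds _).ne'
  obtain ⟨hp1, hq1⟩ := factorization_conductorNorm_196A1
  have hle := (Nat.factorization_le_iff_dvd hN0 (by norm_num : (784 : ℕ) ≠ 0)).mpr conductorNorm_dvd_196A1
  have eN : (196 : ℕ) = 2 ^ 2 * 7 ^ 2 := by norm_num
  have eΔ : (784 : ℕ) = 2 ^ 4 * 7 ^ 2 := by norm_num
  refine Nat.eq_of_factorization_eq hN0 (by norm_num) fun r => ?_
  rw [eN, factorization_2_pow_mul_7_pow_196A1]
  by_cases hrp : r = 2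
  · subst hrp; rw [hp1]; simp
  by_cases hrq : r = 7
  · subst hrq; rw [hq1]; simp
  have hr' := hle r
  rw [eΔ, factorization_2_pow_mul_7_pow_196A1, if_neg hrp, if_neg hrq] at hr'
  rw [if_neg hrp, if_neg hrq]
  exact Nat.le_zero.mp hr'

/-- **`N(196a1) < 5000`** (Creutz–Miller's range). [cite: CreutzMiller2012, Thm. 1.1] -/
theorem conductorNorm_lt_5000_196A1 :
    haveI := isElliptic_196A1
    (⟨0, -1, 0, -2, 1⟩ : WeierstrassCurve ℚ).conductorNorm ℤ < 5000 := by
  rw [conductorNorm_196A1]; norm_num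

/-- **Kriz–Li's local hypotheses at `2` for `196a1`**: `c₂` odd (kernel: type `IV`) and — `E` being ADDITIVE at `2` — the Manin constant `Dt.c` of the OPTIMAL
datum odd, by print (Agashe–Ribet–Stein Thm. 2.6 / Cremona: `|c| = 1` at level `≤ 130000`, `h26`).
[cite: KrizLi2019, Thm. 5.1 hypotheses "c₂(E) odd; Manin constant odd if additive at 2"] [cite: AgasheRibetStein2006, Thm. 2.6] -/
theorem krizLi_loc_196A1 (h26 : cremona_abs_maninConstant_eq_one_of_level_le)
    [haveI := isElliptic_196A1; NeZero ((⟨0, -1, 0, -2, 1⟩ : WeierstrassCurve ℚ).conductorNorm ℤ)]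
    (Dt : haveI := isElliptic_196A1; ModularParametrizationData (⟨0, -1, 0, -2, 1⟩ : WeierstrassCurve ℚ) ((⟨0, -1, 0, -2, 1⟩ : WeierstrassCurve ℚ).conductorNorm ℤ))
    (hopt : haveI := isElliptic_196A1; Zhai2021.IsOptimalDatum (⟨0, -1, 0, -2, 1⟩ : WeierstrassCurve ℚ) Dt) :
    haveI := isElliptic_196A1; haveI : Fact (2 : ℕ).Prime := ⟨Nat.prime_two⟩
    Odd (((⟨0, -1, 0, -2, 1⟩ : WeierstrassCurve ℚ).baseChange ℚ_[2]).localTamagawaNumber ℤ_[2]) ∧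
      (¬ (⟨0, -1, 0, -2, 1⟩ : WeierstrassCurve ℚ).HasGoodReductionAtPrime 2 → ¬ (⟨0, -1, 0, -2, 1⟩ : WeierstrassCurve ℚ).HasMultiplicativeReductionAtPrime 2 → Odd Dt.c) := by
  haveI := isElliptic_196A1; haveI := isGloballyMinimal_196A1
  refine ⟨odd_localTamagawaNumber_two_196A1, fun _ _ => ?_⟩
  have hc : ¬ (2 : ℤ) ∣ Dt.c := not_two_dvd_c_of_level_le h26 _ Dt hopt (by rw [conductorNorm_196A1]; norm_num)
  exact Int.not_even_iff_odd.mp fun h => hc (even_iff_two_dvd.mp h)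

/-- **The Heegner hypothesis for `(196a1, K)`, `d_K = -31`**: the primes `2`, `7` of `N = 196` split in `K` (`d_K ≡ 1 (mod 8)`, `(-31/7) = 1`).
[cite: KrizLi2019, Thm. 5.1 hypothesis "K satisfies the Heegner hypothesis for N"] [cite: Marcus1977, Ch. 3 Thm. 25] -/
theorem satisfiesHeegnerHypothesis_196A1 {K : Type} [Field K] [NumberField K] (h2 : Module.finrank ℚ K = 2)
    (hdK : NumberField.discr K = -31) :
    haveI := isElliptic_196A1
    SatisfiesHeegnerHypothesis ((⟨0, -1, 0, -2, 1⟩ : WeierstrassCurve ℚ).conductorNorm ℤ) K := by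
  rw [conductorNorm_196A1, satisfiesHeegnerHypothesis_iff_kronecker _ K h2, hdK]
  intro r hr hrN
  have hrN' : r ∣ 2 ^ 2 * 7 ^ 2 := by norm_num at hrN ⊢; exact hrN
  rcases (Nat.Prime.dvd_mul hr).mp hrN' with h | h
  · obtain rfl := (Nat.prime_dvd_prime_iff_eq hr Nat.prime_two).mp (hr.dvd_of_dvd_pow h)
    exact ⟨fun _ => by decide, fun h => absurd rfl h⟩
  · obtain rfl := (Nat.prime_dvd_prime_iff_eq hr (by norm_num)).mp (hr.dvd_of_dvd_pow h)
    exact ⟨fun h => absurd h (by norm_num), fun _ => by norm_num⟩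

/-- **`#Ẽ(𝔽₅) = 9` for `196a1`** (certified count), so `a₅ = -3`. [cite: SilvermanAEC2009, V.2] -/
theorem reductionPointCount_5_196A1 :
    haveI := isGloballyMinimal_196A1
    (⟨0, -1, 0, -2, 1⟩ : WeierstrassCurve ℚ).reductionPointCount 5 = 9 := by
  haveI : Fact (Nat.Prime 5) := ⟨by norm_num⟩
  haveI := isElliptic_196A1; haveI := isGloballyMinimal_196A1
  exact Supersingular.reductionPointCount_eq_of_intModel_countPoints intModel_196A1 5 (by norm_num) (by decide +kernel)
    (by decide +kernel)

/-- **`a₅(196a1)` is odd** (`Frob₅` has order `3` on `E[2]`). [cite: KrizLi2019, Def. 4.1 ("Frob_ℓ of order 3")] -/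
theorem odd_frobeniusTrace_5_196A1 :
    haveI := isGloballyMinimal_196A1
    Odd ((⟨0, -1, 0, -2, 1⟩ : WeierstrassCurve ℚ).frobeniusTrace 5) := by
  haveI := isGloballyMinimal_196A1
  rw [Uniform.U2.odd_frobeniusTrace_iff_odd_reductionPointCount _ (by norm_num : Nat.Prime 5) (by norm_num),
    reductionPointCount_5_196A1]
  decide

/-- **`#Ẽ(𝔽₁₀₁) = 117` for `196a1`** (certified count), so `a₁₀₁ = -15`. [cite: SilvermanAEC2009, V.2] -/
theorem reductionPointCount_101_196A1 :
    haveI := isGloballyMinimal_196A1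
    (⟨0, -1, 0, -2, 1⟩ : WeierstrassCurve ℚ).reductionPointCount 101 = 117 := by
  haveI : Fact (Nat.Prime 101) := ⟨by norm_num⟩
  haveI := isElliptic_196A1; haveI := isGloballyMinimal_196A1
  exact Supersingular.reductionPointCount_eq_of_intModel_countPoints intModel_196A1 101 (by norm_num) (by decide +kernel)
    (by decide +kernel)

/-- **`a₁₀₁(196a1)` is odd** (`Frob₁₀₁` has order `3` on `E[2]`). [cite: KrizLi2019, Def. 4.1 ("Frob_ℓ of order 3")] -/
theorem odd_frobeniusTrace_101_196A1 :
    haveI := isGloballyMinimal_196A1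
    Odd ((⟨0, -1, 0, -2, 1⟩ : WeierstrassCurve ℚ).frobeniusTrace 101) := by
  haveI := isGloballyMinimal_196A1
  rw [Uniform.U2.odd_frobeniusTrace_iff_odd_reductionPointCount _ (by norm_num : Nat.Prime 101) (by norm_num),
    reductionPointCount_101_196A1]
  decide

end Base196A1

end Summit.BirchSwinnertonDyer.BirchSwinnertonDyer.Theorems.GenusExact.TwinSwap.KrizLiAnchor196a1

end
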